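/-
Copyright: literature anchor typed for the h21 tree. Source: H. Schneider, *Positive operators and an
inertia theorem*, Numer. Math. 7 (1965) 11–17 [Schneider1965] — the description of the linear maps `T`
with `T(PSD) = PSD` (paywalled, acquisition acq-14318; statement confirmed from two held secondary
sources that restate it with attribution: R. Sznajder, *A representation theorem for the Lorentz cone
automorphisms*, J. Optim. Theory Appl. 202 (2022) 296–302 [Sznajder2022], §2 Example 2 (held text
`paper:arxiv-2103.09989` chunk p0004), and S. Furtado, C. R. Johnson, Y. Zhang, *Linear preservers of
copositive matrices*, Linear Multilinear Algebra 69 (2019) [FurtadoJohnsonZhang2019], §1 (held text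
chunk p0002)).
-/
import Mathlib
import Literature.LinearAlgebra.Matrix.PsdConeFaces
import HarnessLib

/-!
# Linear automorphisms of the cone of positive semidefinite matrices are congruences (Schneider 1965)

Source texts (verbatim). Sznajder 2022, §1 (chunk p0003): "`S` is a cone automorphism (`S ∈ Aut(K)`) if
`S` is a linear transformation satisfying the condition `S(K) = K`", and §2 Example 2 (chunk p0004):

> Let `S^n` be the set of all `n × n` real symmetric matrices […] the cone of squares `S^n_+` is the set
> of all positive semidefinite matrices in `S^n`. It is known (see Schneider [Schneider1965]) that the
> corresponding to any `Γ ∈ Aut(S^n_+)`, there exists an invertible matrix `Q ∈ ℝ^{n×n}` such that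
> `Γ(X) = Q X Qᵀ (X ∈ S^n)`.

Furtado–Johnson–Zhang 2019, §1 (chunk p0002): "If `L(C) = C`, we have an onto […] preserver. […] The
onto linear preservers of PSD are straight forwardly known to be the congruences by a fixed invertible
matrix [Schneider1965]."

## What is formalised

Matrices are real `n × n` over a finite index type `n`; `S^n_+` is the tree's
`psdCone n = {A | A.PosSemidef}` (`PsdConeFaces.lean`). A linear map is taken on all of
`Matrix n n ℝ` (only its values on symmetric matrices matter, exactly as in Furtado–Johnson–Zhang §1:
"it may also be convenient to consider `L` to be a linear map on `M_n(ℝ)`"), and "`Γ ∈ Aut(S^n_+)`" is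
the set equality `Γ '' psdCone n = psdCone n`.

* **Schneider's theorem** (`exists_eq_transpose_mul_mul_of_image_psdCone_eq`): if
  `Γ '' psdCone n = psdCone n` then there is an invertible `G` with `Γ(X) = Gᵀ X G` for every symmetric
  `X` (the printed `Q = Gᵀ`); with the converse (`image_psdCone_eq_of_eq_transpose_mul_mul`, congruences
  are automorphisms) packaged as the characterisation `image_psdCone_eq_iff`.
* The proof is the classical linear-preserver road, self-contained over the tree: (1) every symmetric
  matrix is a difference of two psd ones (`4X = (1+X)ᵀ(1+X) − (1−X)ᵀ(1−X)`), so `Γ` maps the symmetric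
  matrices ONTO themselves, hence injectively (finite dimension) — `eq_of_apply_eq`; (2) `Γ` therefore
  maps extreme rays of `S^n_+` to extreme rays, and by the tree's BPT App. A §A.3.5
  (`PsdConeFaces.isExtreme_nonnegRay_vecMulVec` / `exists_eq_vecMulVec_of_isExtreme`) `Γ(xxᵀ) = zzᵀ`
  (`exists_apply_vecMulVec_eq`); (3) `Γ(I)` is positive definite (`posDef_apply_one`, via the tree's
  Loewner domination lemma `exists_smul_sub_posSemidef_of_isHermitian`), so the vectors `z_i` with
  `Γ(e_ie_iᵀ) = z_iz_iᵀ` form an invertible matrix `G₀` and `X ↦ G₀⁻¹Γ(X)G₀⁻ᵀ` fixes every `e_ie_iᵀ`;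
  (4) the core computation (`exists_diagonal_of_apply_single_eq`): a linear map sending every `xxᵀ` to
  some `zzᵀ` and fixing the `e_ie_iᵀ` is `X ↦ DXD` on symmetric `X` for a diagonal sign matrix `D`
  (entries of the rank-one values of `(se_i+te_j)(se_i+te_j)ᵀ` force
  `Γ(e_ie_jᵀ + e_je_iᵀ) = ±(e_ie_jᵀ + e_je_iᵀ)`, and the values at `e_i+e_j+e_l` make the signs a
  coboundary `ε_{ij} = δ_iδ_j`).

* Corollaries (appended): `S^n_+` is homogeneous — for `A, B ≻ 0` some invertible `G` has `GᵀAG = B`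
  (`exists_transpose_mul_mul_eq_of_posDef`, Sznajder §1 "self-dual and homogeneous"); and a cone
  automorphism with `Γ(I) = I` is an ORTHOGONAL congruence
  (`exists_orthogonal_of_image_psdCone_eq_of_map_one`, the second display of Sznajder's Example 2).

No definitions, no named facts. Motivation in the tree: this is the "automorphism of the psd cone" step
of H. Fawzi, J. Gouveia, P. A. Parrilo, R. Z. Robinson, R. R. Thomas, *Positive semidefinite rank*,
Math. Program. 153 (2015), §7 Corollary 7.4 (the `GL(k)`-action `g · π(L) = π(gLgᵀ)` on `Δ_k(P,Q)`
exhausts the maps with a given image `π(S^k_+)`), used in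
`Literature/Combinatorics/Optimization/NestedConeImagesOfFactorizations.lean`.
-/

open Matrix Set

namespace Literature.LinearAlgebra.Matrix.PsdConeLinearAutomorphisms

open Literature.LinearAlgebra.Matrix.PsdConeFaces (psdCone mem_psdCone_iff
  isExtreme_nonnegRay_vecMulVec exists_eq_vecMulVec_of_isExtreme)
open Literature.LinearAlgebra.Matrix.SpectrahedralConeExtremeRays (nonnegRay mem_nonnegRay_iff
  exists_smul_sub_posSemidef_of_isHermitian)

variable {n : Type*} [Fintype n] [DecidableEq n]

/-! ### Symmetric matrices are differences of psd matrices; onto preservers are injective -/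

omit [Fintype n] [DecidableEq n] in
/-- Over `ℝ`, Hermitian means symmetric. [folklore] -/
private theorem isHermitian_iff_isSymm {S : Matrix n n ℝ} : S.IsHermitian ↔ S.IsSymm := by
  rw [Matrix.IsHermitian, conjTranspose_eq_transpose_of_trivial]
  rfl

/-- Every real symmetric matrix is a difference of two psd matrices:
`4X = (1+X)ᵀ(1+X) − (1−X)ᵀ(1−X)`. [folklore] -/
private theorem exists_posSemidef_sub_eq_of_isHermitian {S : Matrix n n ℝ} (hS : S.IsHermitian) :
    ∃ P N : Matrix n n ℝ, P.PosSemidef ∧ N.PosSemidef ∧ S = P - N := by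
  refine ⟨(1 / 4 : ℝ) • ((1 + S)ᴴ * (1 + S)), (1 / 4 : ℝ) • ((1 - S)ᴴ * (1 - S)),
    (posSemidef_conjTranspose_mul_self _).smul (by norm_num),
    (posSemidef_conjTranspose_mul_self _).smul (by norm_num), ?_⟩
  have h1 : (1 + S)ᴴ = 1 + S := by rw [conjTranspose_add, conjTranspose_one, hS.eq]
  have h2 : (1 - S)ᴴ = 1 - S := by rw [conjTranspose_sub, conjTranspose_one, hS.eq]
  rw [h1, h2, ← smul_sub]
  ext i j
  simp only [Matrix.smul_apply, Matrix.sub_apply, Matrix.add_mul, Matrix.mul_add, Matrix.sub_mul,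
    Matrix.mul_sub, Matrix.one_mul, Matrix.mul_one, Matrix.add_apply, smul_eq_mul]
  ring

section Preserver

variable (ψ : Matrix n n ℝ →ₗ[ℝ] Matrix n n ℝ)

/-- An into psd preserver maps symmetric matrices to symmetric matrices. [folklore] -/
private theorem isHermitian_apply (h1 : ∀ L : Matrix n n ℝ, L.PosSemidef → (ψ L).PosSemidef)
    {S : Matrix n n ℝ} (hS : S.IsHermitian) : (ψ S).IsHermitian := by
  obtain ⟨P, N, hP, hN, rfl⟩ := exists_posSemidef_sub_eq_of_isHermitian hS
  rw [map_sub]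
  exact (h1 P hP).1.sub (h1 N hN).1

/-- An onto psd preserver (`Γ(S^n_+) ⊆ S^n_+` and `S^n_+ ⊆ Γ(S^n_+)`) is injective on symmetric
matrices: it maps the finite-dimensional space of symmetric matrices onto itself.
[cite: FurtadoJohnsonZhang2019, §1 (held chunk p0002)] -/
theorem eq_of_apply_eq (h1 : ∀ L : Matrix n n ℝ, L.PosSemidef → (ψ L).PosSemidef)
    (h2 : ∀ P : Matrix n n ℝ, P.PosSemidef → ∃ L : Matrix n n ℝ, L.PosSemidef ∧ ψ L = P)
    {S T : Matrix n n ℝ} (hS : S.IsHermitian) (hT : T.IsHermitian) (hST : ψ S = ψ T) : S = T := by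
  let W : Submodule ℝ (Matrix n n ℝ) := selfAdjoint.submodule ℝ (Matrix n n ℝ)
  have hmem : ∀ {X : Matrix n n ℝ}, X ∈ W ↔ X.IsHermitian := Iff.rfl
  have hmaps : ∀ X ∈ W, ψ X ∈ W := fun X hX => hmem.2 (isHermitian_apply ψ h1 (hmem.1 hX))
  have hsurj : Function.Surjective (ψ.restrict hmaps) := by
    rintro ⟨X, hX⟩
    obtain ⟨P, N, hP, hN, rfl⟩ := exists_posSemidef_sub_eq_of_isHermitian (hmem.1 hX)
    obtain ⟨P', hP', rfl⟩ := h2 P hP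
    obtain ⟨N', hN', rfl⟩ := h2 N hN
    refine ⟨⟨P' - N', hmem.2 (hP'.1.sub hN'.1)⟩, Subtype.ext ?_⟩
    simp [LinearMap.restrict_apply, map_sub]
  have hinj : Function.Injective (ψ.restrict hmaps) := LinearMap.injective_iff_surjective.2 hsurj
  have key : (⟨S, hmem.2 hS⟩ : W) = ⟨T, hmem.2 hT⟩ :=
    hinj (Subtype.ext (by simpa [LinearMap.restrict_apply] using hST))
  exact congrArg Subtype.val key

/-- In particular `Γ⁻¹` is also positive: a symmetric `S` with `Γ(S) ⪰ 0` is itself `⪰ 0`.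
[cite: FurtadoJohnsonZhang2019, §1 (held chunk p0002)] -/
theorem posSemidef_of_apply (h1 : ∀ L : Matrix n n ℝ, L.PosSemidef → (ψ L).PosSemidef)
    (h2 : ∀ P : Matrix n n ℝ, P.PosSemidef → ∃ L : Matrix n n ℝ, L.PosSemidef ∧ ψ L = P)
    {S : Matrix n n ℝ} (hS : S.IsHermitian) (hψS : (ψ S).PosSemidef) : S.PosSemidef := by
  obtain ⟨L, hL, hψL⟩ := h2 _ hψS
  rw [eq_of_apply_eq ψ h1 h2 hS hL.1 hψL.symm]
  exact hL

/-! ### Extreme rays go to extreme rays: `Γ(xxᵀ) = zzᵀ` -/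

/-- An onto psd preserver maps extreme rays of `S^n_+` to extreme rays. (Linear bijections of a
cone preserve its faces.) [folklore] -/
private theorem isExtreme_nonnegRay_apply (h1 : ∀ L : Matrix n n ℝ, L.PosSemidef → (ψ L).PosSemidef)
    (h2 : ∀ P : Matrix n n ℝ, P.PosSemidef → ∃ L : Matrix n n ℝ, L.PosSemidef ∧ ψ L = P)
    {X : Matrix n n ℝ} (hX : X.PosSemidef) (hext : IsExtreme ℝ (psdCone n) (nonnegRay X)) :
    IsExtreme ℝ (psdCone n) (nonnegRay (ψ X)) := by
  refine ⟨?_, ?_⟩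
  · rintro _ ⟨t, ht, rfl⟩
    rw [mem_psdCone_iff, ← map_smul]
    exact h1 _ (hX.smul ht)
  · rintro A' hA' B' hB' _ ⟨t, ht, rfl⟩ hseg
    obtain ⟨A, hA, rfl⟩ := h2 A' hA'
    obtain ⟨B, hB, rfl⟩ := h2 B' hB'
    obtain ⟨a, b, ha, hb, hab, hc⟩ := hseg
    have hcomb : a • A + b • B = t • X := by
      refine eq_of_apply_eq ψ h1 h2 ((hA.smul ha.le).1.add (hB.smul hb.le).1) (hX.smul ht).1 ?_
      rw [map_add, map_smul, map_smul, hc, map_smul]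
    have hmemray : a • A + b • B ∈ nonnegRay X := ⟨t, ht, hcomb⟩
    have hsegAB : a • A + b • B ∈ openSegment ℝ A B := ⟨a, b, ha, hb, hab, rfl⟩
    obtain ⟨t₁, ht₁, hA₁⟩ := hext.left_mem_of_mem_openSegment hA hB hmemray hsegAB
    exact ⟨t₁, ht₁, by rw [hA₁, map_smul]⟩

/-- **Rank-one values.** An onto psd preserver sends every `xxᵀ` to some `zzᵀ` (the extreme rays of
`S^n_+` are exactly the rays of the `xxᵀ`, BPT App. A §A.3.5, in the tree).
[cite: BlekhermanParriloThomas2012, App. A §A.3.5 (held chunk p0439)] -/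
theorem exists_apply_vecMulVec_eq (h1 : ∀ L : Matrix n n ℝ, L.PosSemidef → (ψ L).PosSemidef)
    (h2 : ∀ P : Matrix n n ℝ, P.PosSemidef → ∃ L : Matrix n n ℝ, L.PosSemidef ∧ ψ L = P)
    (x : n → ℝ) : ∃ z : n → ℝ, ψ (vecMulVec x x) = vecMulVec z z := by
  rcases eq_or_ne x 0 with rfl | hx
  · exact ⟨0, by simp⟩
  have hX : (vecMulVec x x).PosSemidef := by simpa using posSemidef_vecMulVec_self_star x
  have hX0 : vecMulVec x x ≠ 0 := by simp [hx]
  have hψX0 : ψ (vecMulVec x x) ≠ 0 := fun h =>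
    hX0 (eq_of_apply_eq ψ h1 h2 hX.1 isHermitian_zero (by rw [h, map_zero]))
  obtain ⟨v, -, hv⟩ := exists_eq_vecMulVec_of_isExtreme (h1 _ hX) hψX0
    (isExtreme_nonnegRay_apply ψ h1 h2 hX (isExtreme_nonnegRay_vecMulVec hx))
  exact ⟨v, hv⟩

/-! ### `Γ(I)` is positive definite -/

/-- An onto psd preserver sends the identity to a positive DEFINITE matrix: `I = Γ(L₀)` with
`L₀ ⪰ 0`, `L₀ ⪯ c I`, so `I ⪯ c Γ(I)`. [folklore] -/
private theorem posDef_apply_one (h1 : ∀ L : Matrix n n ℝ, L.PosSemidef → (ψ L).PosSemidef)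
    (h2 : ∀ P : Matrix n n ℝ, P.PosSemidef → ∃ L : Matrix n n ℝ, L.PosSemidef ∧ ψ L = P) :
    (ψ 1).PosDef := by
  obtain ⟨L₀, hL₀, hψL₀⟩ := h2 1 PosSemidef.one
  obtain ⟨c, hc, hcL⟩ := exists_smul_sub_posSemidef_of_isHermitian PosSemidef.one hL₀.1
    (fun v hv => by rw [one_mulVec] at hv; rw [hv, mulVec_zero])
  have hpsd : (c • ψ 1 - 1).PosSemidef := by
    have h := h1 _ hcL
    rwa [map_sub, map_smul, hψL₀] at h
  refine PosDef.of_dotProduct_mulVec_pos (h1 1 PosSemidef.one).1 fun w hw => ?_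
  have h0 := hpsd.dotProduct_mulVec_nonneg w
  rw [sub_mulVec, dotProduct_sub, smul_mulVec, dotProduct_smul, one_mulVec, sub_nonneg,
    smul_eq_mul] at h0
  have hww : 0 < star w ⬝ᵥ w := dotProduct_star_self_pos_iff.mpr hw
  by_contra hq
  push Not at hq
  have h3 := mul_le_mul_of_nonneg_left hq hc
  rw [mul_zero] at h3
  linarith

end Preserver

/-! ### The core computation: a rank-one preserver fixing the `e_ie_iᵀ` is a diagonal sign congruence -/

section Core

omit [Fintype n] in
/-- `(se_i + te_j)(se_i + te_j)ᵀ = s²E_ii + st(E_ij + E_ji) + t²E_jj`. [folklore] -/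
private theorem vecMulVec_single_add_single (i j : n) (s t : ℝ) :
    vecMulVec (s • Pi.single i (1 : ℝ) + t • Pi.single j 1) (s • Pi.single i 1 + t • Pi.single j 1) =
      (s * s) • single i i (1 : ℝ) + (s * t) • (single i j 1 + single j i 1) +
        (t * t) • single j j 1 := by
  simp only [single_eq_single_vecMulVec_single, add_vecMulVec, vecMulVec_add, smul_vecMulVec,
    vecMulVec_smul, smul_smul, smul_add, mul_comm t s]
  abel

omit [Fintype n] in
/-- `(e_i + e_j + e_l)(e_i + e_j + e_l)ᵀ` expanded in matrix units. [folklore] -/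
private theorem vecMulVec_single_add_single_add_single (i j l : n) :
    vecMulVec (Pi.single i (1 : ℝ) + Pi.single j 1 + Pi.single l 1)
        (Pi.single i 1 + Pi.single j 1 + Pi.single l 1) =
      single i i (1 : ℝ) + single j j 1 + single l l 1 + (single i j 1 + single j i 1) +
        (single i l 1 + single l i 1) + (single j l 1 + single l j 1) := by
  simp only [single_eq_single_vecMulVec_single, add_vecMulVec, vecMulVec_add]
  abel

/-- A symmetric matrix in matrix units: `S = Σ_{i,j} (S_{ij}/2)(E_{ij} + E_{ji})`. [folklore] -/
private theorem eq_sum_smul_single_add_single {S : Matrix n n ℝ} (hS : S.IsSymm) :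
    S = ∑ i, ∑ j, (S i j / 2) • (single i j (1 : ℝ) + single j i 1) := by
  ext a b
  simp only [Matrix.sum_apply, Matrix.add_apply, Matrix.smul_apply, smul_eq_mul, single_apply,
    mul_add, Finset.sum_add_distrib, mul_ite, mul_one, mul_zero, ite_and, Finset.sum_ite_eq',
    Finset.mem_univ, if_true]
  rw [Finset.sum_comm]
  simp only [Finset.sum_ite_eq', Finset.mem_univ, if_true, hS.apply a b]
  ring

/-- `D (E_ij + E_ji) D = δ_iδ_j (E_ij + E_ji)` for `D = diag(δ)`. [folklore] -/
private theorem diagonal_mul_single_add_single_mul_diagonal (δ : n → ℝ) (i j : n) :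
    diagonal δ * (single i j (1 : ℝ) + single j i 1) * diagonal δ =
      (δ i * δ j) • (single i j (1 : ℝ) + single j i 1) := by
  ext a b
  simp only [mul_diagonal, diagonal_mul, Matrix.add_apply, Matrix.smul_apply, smul_eq_mul,
    single_apply]
  by_cases h1 : i = a ∧ j = b
  · obtain ⟨rfl, rfl⟩ := h1
    by_cases h2 : j = i ∧ i = j
    · obtain ⟨h3, -⟩ := h2
      subst h3
      simp only [and_self, if_true]
      ring
    · simp [h2]
  · by_cases h2 : j = a ∧ i = b
    · obtain ⟨rfl, rfl⟩ := h2
      simp [h1, mul_comm]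
    · simp [h1, h2]

variable (φ : Matrix n n ℝ →ₗ[ℝ] Matrix n n ℝ)

omit [Fintype n] in
/-- **Off-diagonal units.** If a linear `φ` sends every `xxᵀ` to some `zzᵀ` and fixes the `E_ii`,
then for `i ≠ j`, `φ(E_ij + E_ji) = β(E_ij + E_ji)` with `β = ±1`: the entries of the rank-one values
`φ((se_i+te_j)(se_i+te_j)ᵀ) = s²E_ii + st·φ(E_ij+E_ji) + t²E_jj` leave no other possibility (the
Marcus–Moyls / Schneider rank-one road). [folklore] -/
private theorem exists_apply_single_add_single_eq
    (hvec : ∀ x : n → ℝ, ∃ z : n → ℝ, φ (vecMulVec x x) = vecMulVec z z)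
    (hdiag : ∀ i, φ (single i i 1) = single i i 1) {i j : n} (hij : i ≠ j) :
    ∃ β : ℝ, β * β = 1 ∧ φ (single i j 1 + single j i 1) = β • (single i j (1 : ℝ) + single j i 1) := by
  set B := φ (single i j 1 + single j i 1) with hB
  -- the entries of the rank-one values `R(s,t)`
  have hR : ∀ s t : ℝ, ∃ z : n → ℝ, ∀ a b,
      s * s * single i i (1 : ℝ) a b + s * t * B a b + t * t * single j j (1 : ℝ) a b = z a * z b := by
    intro s t
    obtain ⟨z, hz⟩ := hvec (s • Pi.single i 1 + t • Pi.single j 1)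
    refine ⟨z, fun a b => ?_⟩
    have h := congrFun (congrFun hz a) b
    rw [vecMulVec_single_add_single, map_add, map_add, map_smul, map_smul, map_smul, hdiag,
      hdiag] at h
    simpa only [Matrix.add_apply, Matrix.smul_apply, smul_eq_mul, vecMulVec_apply] using h
  -- (1) entries outside the `{i,j} × {i,j}` block vanish
  have off : ∀ a, a ≠ i → a ≠ j → ∀ b, B a b = 0 ∧ B b a = 0 := by
    intro a hai haj
    obtain ⟨z, hz⟩ := hR 1 1
    obtain ⟨z', hz'⟩ := hR 1 (-1)
    have h1 := hz a a
    have h2 := hz' a a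
    rw [single_apply_of_row_ne (Ne.symm hai), single_apply_of_row_ne (Ne.symm haj)] at h1 h2
    have hBaa : B a a = 0 := by nlinarith [mul_self_nonneg (z a), mul_self_nonneg (z' a)]
    have hza : z a = 0 := by
      have h3 : z a * z a = 0 := by rw [← h1, hBaa]; ring
      exact mul_self_eq_zero.mp h3
    intro b
    have h4 := hz a b
    have h5 := hz b a
    rw [single_apply_of_row_ne (Ne.symm hai), single_apply_of_row_ne (Ne.symm haj), hza] at h4
    rw [single_apply_of_col_ne _ _ (Ne.symm hai), single_apply_of_col_ne _ _ (Ne.symm haj), hza]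
      at h5
    constructor
    · linarith
    · linarith
  -- (2) the diagonal entries `B_ii`, `B_jj` vanish (`1 + τ B_ii ≥ 0` for all `τ`)
  have hBii : B i i = 0 := by
    by_contra hne
    obtain ⟨z, hz⟩ := hR 1 (-2 / B i i)
    have h := hz i i
    rw [single_apply_same, single_apply_of_row_ne (Ne.symm hij)] at h
    have h' : (1 : ℝ) * 1 * 1 + 1 * (-2 / B i i) * B i i + -2 / B i i * (-2 / B i i) * 0 = -1 := by
      field_simp
      ring
    nlinarith [mul_self_nonneg (z i)]
  have hBjj : B j j = 0 := by
    by_contra hne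
    obtain ⟨z, hz⟩ := hR (-2 / B j j) 1
    have h := hz j j
    rw [single_apply_same, single_apply_of_row_ne hij] at h
    have h' : -2 / B j j * (-2 / B j j) * 0 + -2 / B j j * 1 * B j j + (1 : ℝ) * 1 * 1 = -1 := by
      field_simp
      ring
    nlinarith [mul_self_nonneg (z j)]
  -- (3) the value at `s = t = 1`
  obtain ⟨z, hz⟩ := hR 1 1
  have hzi : z i * z i = 1 := by
    have h := hz i i
    rw [single_apply_same, single_apply_of_row_ne (Ne.symm hij), hBii] at h
    linarith
  have hzj : z j * z j = 1 := by
    have h := hz j j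
    rw [single_apply_same, single_apply_of_row_ne hij, hBjj] at h
    linarith
  have hBij : B i j = z i * z j := by
    have h := hz i j
    rw [single_apply_of_col_ne _ _ hij, single_apply_of_row_ne (Ne.symm hij)] at h
    linarith
  have hBji : B j i = z j * z i := by
    have h := hz j i
    rw [single_apply_of_row_ne hij, single_apply_of_col_ne _ _ (Ne.symm hij)] at h
    linarith
  refine ⟨B i j, ?_, ?_⟩
  · calc B i j * B i j = (z i * z i) * (z j * z j) := by rw [hBij]; ring
      _ = 1 := by rw [hzi, hzj, one_mul]
  · ext a b
    simp only [Matrix.add_apply, Matrix.smul_apply, smul_eq_mul, single_apply]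
    rcases eq_or_ne a i with rfl | hai
    · rcases eq_or_ne b j with rfl | hbj
      · simp [Ne.symm hij]
      · have h0 : B a b = 0 := by
          rcases eq_or_ne b a with rfl | hba
          · exact hBii
          · exact (off b hba hbj a).2
        simp [h0, Ne.symm hbj, hij.symm]
    · rcases eq_or_ne a j with rfl | haj
      · rcases eq_or_ne b i with rfl | hbi
        · have h0 : B a b = B b a := by rw [hBji, hBij, mul_comm]
          simp [h0, hij]
        · have h0 : B a b = 0 := by
            rcases eq_or_ne b a with rfl | hba
            · exact hBjj
            · exact (off b hbi hba a).2
          simp [h0, Ne.symm hai, Ne.symm hbi]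
      · have h0 : B a b = 0 := (off a hai haj b).1
        simp [h0, Ne.symm hai, Ne.symm haj]

/-- **The core computation.** A linear map on `M_n(ℝ)` that sends every `xxᵀ` to some `zzᵀ` and fixes
every matrix unit `E_ii` is, on symmetric matrices, the congruence `X ↦ DXD` by a diagonal SIGN matrix
`D = diag(δ)`, `δ_i = ±1`. (The signs `ε_{ij} = ±1` of `φ(E_ij + E_ji) = ε_{ij}(E_ij + E_ji)` satisfy
`ε_{jl} = ε_{ij}ε_{il}` — read off the rank-one value at `e_i + e_j + e_l` — hence `ε_{jl} = δ_jδ_l`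
with `δ_j = ε_{i₀j}`; the Marcus–Moyls / Schneider rank-one road.) [folklore] -/
private theorem exists_diagonal_of_apply_single_eq
    (hvec : ∀ x : n → ℝ, ∃ z : n → ℝ, φ (vecMulVec x x) = vecMulVec z z)
    (hdiag : ∀ i, φ (single i i 1) = single i i 1) :
    ∃ δ : n → ℝ, (∀ i, δ i * δ i = 1) ∧
      ∀ S : Matrix n n ℝ, S.IsSymm → φ S = diagonal δ * S * diagonal δ := by
  classical
  choose! β hβ1 hβ using fun i j (h : i ≠ j) => exists_apply_single_add_single_eq φ hvec hdiag h
  -- the sign table `ε`, with `ε_ii = 1`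
  set ε : n → n → ℝ := fun i j => if i = j then 1 else β i j with hεdef
  have hε : ∀ i j, φ (single i j 1 + single j i 1) = ε i j • (single i j (1 : ℝ) + single j i 1) := by
    intro i j
    by_cases h : i = j
    · subst h
      rw [map_add, hdiag]
      simp [ε]
    · simp only [ε, if_neg h]
      exact hβ i j h
  have hε1 : ∀ i j, ε i j * ε i j = 1 := by
    intro i j
    by_cases h : i = j
    · simp [ε, h]
    · simp only [ε, if_neg h]
      exact hβ1 i j h
  have hεii : ∀ i, ε i i = 1 := fun i => by simp [ε]
  have hεsymm : ∀ i j, ε i j = ε j i := by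
    intro i j
    by_cases h : i = j
    · rw [h]
    · have h1 := hε i j
      have h2 := hε j i
      rw [add_comm (single j i (1 : ℝ)), h1] at h2
      have h3 := congrFun (congrFun h2 i) j
      simp only [Matrix.smul_apply, Matrix.add_apply, single_apply_same,
        single_apply_of_row_ne (Ne.symm h), smul_eq_mul, add_zero, mul_one] at h3
      exact h3
  -- the cocycle identity from the value at `e_i + e_j + e_l`
  have cocycle : ∀ i j l, i ≠ j → i ≠ l → j ≠ l → ε j l = ε i j * ε i l := by
    intro i j l hij hil hjl
    obtain ⟨z, hz⟩ := hvec (Pi.single i 1 + Pi.single j 1 + Pi.single l 1)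
    rw [vecMulVec_single_add_single_add_single, map_add, map_add, map_add, map_add, map_add, hdiag,
      hdiag, hdiag, hε, hε, hε] at hz
    have e := fun a b => congrFun (congrFun hz a) b
    have eii := e i i
    have eij := e i j
    have eil := e i l
    have ejl := e j l
    simp only [Matrix.add_apply, Matrix.smul_apply, smul_eq_mul, single_apply, vecMulVec_apply,
      hij, hil, hjl, Ne.symm hij, Ne.symm hil, Ne.symm hjl, and_true, and_false,
      and_self, if_true, if_false, add_zero, zero_add, mul_one, mul_zero] at eii eij eil ejl
    calc ε j l = (z i * z i) * (z j * z l) := by rw [← eii, one_mul, ejl]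
      _ = ε i j * ε i l := by rw [eij, eil]; ring
  -- the signs are a coboundary
  rcases isEmpty_or_nonempty n with hn | ⟨⟨i₀⟩⟩
  · exact ⟨fun _ => 1, fun i => (IsEmpty.false i).elim, fun S _ => ext fun a _ => (IsEmpty.false a).elim⟩
  have hprod : ∀ j l, ε j l = ε i₀ j * ε i₀ l := by
    intro j l
    by_cases hjl : j = l
    · subst hjl
      rw [hεii, hε1]
    by_cases hj : i₀ = j
    · subst hj
      rw [hεii, one_mul]
    by_cases hl : i₀ = l
    · subst hl
      rw [hεii, mul_one, hεsymm]
    · exact cocycle i₀ j l hj hl hjl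
  refine ⟨fun j => ε i₀ j, fun j => hε1 i₀ j, fun S hS => ?_⟩
  have hSsum := eq_sum_smul_single_add_single hS
  have hφS : φ S = ∑ i, ∑ j, (S i j / 2) • (ε i j • (single i j (1 : ℝ) + single j i 1)) := by
    conv_lhs => rw [hSsum]
    simp only [map_sum, map_smul, hε]
  have hDSD : diagonal (fun j => ε i₀ j) * S * diagonal (fun j => ε i₀ j) =
      ∑ i, ∑ j, (S i j / 2) • (ε i j • (single i j (1 : ℝ) + single j i 1)) := by
    conv_lhs => rw [hSsum]
    simp only [Finset.mul_sum, Finset.sum_mul, Matrix.mul_smul, Matrix.smul_mul,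
      diagonal_mul_single_add_single_mul_diagonal]
    refine Finset.sum_congr rfl fun i _ => Finset.sum_congr rfl fun j _ => ?_
    rw [hprod i j]
  rw [hφS, hDSD]

end Core

/-! ### Schneider's theorem -/

section Main

/-- `I = Σ_i e_ie_iᵀ`. [folklore] -/
private theorem one_eq_sum_vecMulVec_single :
    (1 : Matrix n n ℝ) = ∑ i, vecMulVec (Pi.single i (1 : ℝ)) (Pi.single i 1) := by
  ext a b
  simp only [Matrix.one_apply, Matrix.sum_apply, vecMulVec_apply, Pi.single_apply, mul_ite, mul_one,
    mul_zero, Finset.sum_ite_eq, Finset.mem_univ, if_true]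

variable (ψ : Matrix n n ℝ →ₗ[ℝ] Matrix n n ℝ)

/-- **Schneider's theorem for onto psd preservers, two-inclusion form.** If a linear `Γ` on `M_n(ℝ)`
maps `S^n_+` into itself and onto itself, then `Γ(X) = GᵀXG` on symmetric `X` for an invertible `G`.
Proof: with `Γ(e_ie_iᵀ) = z_iz_iᵀ` (`exists_apply_vecMulVec_eq`), `Γ(I) = G₀G₀ᵀ` for the matrix `G₀`
with columns `z_i`, invertible because `Γ(I) ≻ 0` (`posDef_apply_one`); the normalised map
`X ↦ G₀⁻¹Γ(X)G₀⁻ᵀ` fixes the `e_ie_iᵀ` and still takes rank-one values on the `xxᵀ`, so it is a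
diagonal sign congruence (`exists_diagonal_of_apply_single_eq`), and `G = D G₀ᵀ`.
[cite: Schneider1965, Thm. (onto psd preservers), via Sznajder2022 §2 Example 2 (held chunk p0004)] -/
theorem exists_eq_transpose_mul_mul (h1 : ∀ L : Matrix n n ℝ, L.PosSemidef → (ψ L).PosSemidef)
    (h2 : ∀ P : Matrix n n ℝ, P.PosSemidef → ∃ L : Matrix n n ℝ, L.PosSemidef ∧ ψ L = P) :
    ∃ G : Matrix n n ℝ, IsUnit G ∧ ∀ S : Matrix n n ℝ, S.IsSymm → ψ S = Gᵀ * S * G := by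
  classical
  choose z hz using fun i => exists_apply_vecMulVec_eq ψ h1 h2 (Pi.single i 1)
  -- `G₀` has columns `z_i`
  set G₀ : Matrix n n ℝ := Matrix.of fun a i => z i a with hG₀def
  have hG₀col : ∀ i, G₀ *ᵥ Pi.single i 1 = z i := fun i => by
    ext a
    simp [G₀, Matrix.col_apply]
  have hψ1 : ψ 1 = G₀ * G₀ᵀ := by
    rw [one_eq_sum_vecMulVec_single, map_sum]
    simp_rw [hz]
    ext a b
    simp [Matrix.sum_apply, vecMulVec_apply, Matrix.mul_apply, G₀]
  have hG₀det : IsUnit G₀.det := by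
    have h := (posDef_apply_one ψ h1 h2).isUnit
    rw [hψ1, isUnit_iff_isUnit_det, det_mul, det_transpose] at h
    exact (IsUnit.mul_iff.mp h).1
  have hinv : G₀⁻¹ * G₀ = 1 := nonsing_inv_mul G₀ hG₀det
  have hinv' : G₀ * G₀⁻¹ = 1 := mul_nonsing_inv G₀ hG₀det
  -- the normalised map
  let φ : Matrix n n ℝ →ₗ[ℝ] Matrix n n ℝ :=
    (LinearMap.mulLeft ℝ G₀⁻¹).comp ((LinearMap.mulRight ℝ G₀⁻¹ᵀ).comp ψ)
  have hφ : ∀ X, φ X = G₀⁻¹ * ψ X * G₀⁻¹ᵀ := fun X => by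
    simp [φ, Matrix.mul_assoc]
  have hφvec : ∀ x : n → ℝ, ∃ w : n → ℝ, φ (vecMulVec x x) = vecMulVec w w := by
    intro x
    obtain ⟨w, hw⟩ := exists_apply_vecMulVec_eq ψ h1 h2 x
    exact ⟨G₀⁻¹ *ᵥ w, by rw [hφ, hw, mul_vecMulVec, vecMulVec_mul, vecMul_transpose]⟩
  have hφdiag : ∀ i, φ (single i i 1) = single i i 1 := by
    intro i
    rw [single_eq_single_vecMulVec_single, hφ, hz, mul_vecMulVec, vecMulVec_mul, vecMul_transpose,
      ← hG₀col, mulVec_mulVec, hinv, one_mulVec]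
  obtain ⟨δ, hδ, hφS⟩ := exists_diagonal_of_apply_single_eq φ hφvec hφdiag
  refine ⟨diagonal δ * G₀ᵀ, ?_, fun S hS => ?_⟩
  · rw [isUnit_iff_isUnit_det, det_mul, det_transpose, det_diagonal]
    refine IsUnit.mul (isUnit_iff_ne_zero.mpr ?_) hG₀det
    exact Finset.prod_ne_zero_iff.mpr fun i _ h => by simpa [h] using hδ i
  · have h3 : ψ S = G₀ * φ S * G₀ᵀ := by
      rw [hφ]
      calc ψ S = (G₀ * G₀⁻¹) * ψ S * (G₀ * G₀⁻¹)ᵀ := by rw [hinv', transpose_one, Matrix.one_mul,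
            Matrix.mul_one]
        _ = G₀ * (G₀⁻¹ * ψ S * G₀⁻¹ᵀ) * G₀ᵀ := by rw [transpose_mul]; simp only [Matrix.mul_assoc]
    rw [h3, hφS S hS, transpose_mul, transpose_transpose, diagonal_transpose]
    simp only [Matrix.mul_assoc]

/-- **Schneider's theorem** (real symmetric case): "corresponding to any `Γ ∈ Aut(S^n_+)`" — a linear
`Γ` with `Γ(S^n_+) = S^n_+` — "there exists an invertible matrix `Q ∈ ℝ^{n×n}` such that
`Γ(X) = QXQᵀ (X ∈ S^n)`". Typed with `Γ` a linear map on `M_n(ℝ)`, `S^n_+ = psdCone n`, and the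
conclusion on symmetric `X` with `Q = Gᵀ`.
[cite: Schneider1965, Thm. (onto psd preservers), via Sznajder2022 §2 Example 2 (held chunk p0004);
FurtadoJohnsonZhang2019 §1 (held chunk p0002)] -/
theorem exists_eq_transpose_mul_mul_of_image_psdCone_eq (hψ : ψ '' psdCone n = psdCone n) :
    ∃ G : Matrix n n ℝ, IsUnit G ∧ ∀ S : Matrix n n ℝ, S.IsSymm → ψ S = Gᵀ * S * G := by
  refine exists_eq_transpose_mul_mul ψ (fun L hL => ?_) (fun P hP => ?_)
  · have h : ψ L ∈ ψ '' psdCone n := ⟨L, hL, rfl⟩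
    rw [hψ] at h
    exact h
  · have h : P ∈ ψ '' psdCone n := by rw [hψ]; exact hP
    obtain ⟨L, hL, hLP⟩ := h
    exact ⟨L, hL, hLP⟩

/-- **Converse: congruences are automorphisms of `S^n_+`.** If `Γ(X) = GᵀXG` on symmetric `X` with `G`
invertible, then `Γ(S^n_+) = S^n_+`. [cite: Sznajder2022, §2 Example 2 (held chunk p0004)] -/
theorem image_psdCone_eq_of_eq_transpose_mul_mul {G : Matrix n n ℝ} (hG : IsUnit G)
    (hψ : ∀ S : Matrix n n ℝ, S.IsSymm → ψ S = Gᵀ * S * G) : ψ '' psdCone n = psdCone n := by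
  have hGdet : IsUnit G.det := (isUnit_iff_isUnit_det G).mp hG
  have hcongr : ∀ {L : Matrix n n ℝ} (T : Matrix n n ℝ), L.PosSemidef → (Tᵀ * L * T).PosSemidef :=
    fun T hL => by
      simpa only [conjTranspose_eq_transpose_of_trivial] using hL.conjTranspose_mul_mul_same T
  ext P
  constructor
  · rintro ⟨L, hL, rfl⟩
    rw [mem_psdCone_iff] at hL ⊢
    rw [hψ L (isHermitian_iff_isSymm.mp hL.1)]
    exact hcongr G hL
  · intro hP
    rw [mem_psdCone_iff] at hP
    have hL : (G⁻¹ᵀ * P * G⁻¹).PosSemidef := by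
      have h := hcongr G⁻¹ hP
      rwa [transpose_nonsing_inv] at h ⊢
    refine ⟨G⁻¹ᵀ * P * G⁻¹, hL, ?_⟩
    rw [hψ _ (isHermitian_iff_isSymm.mp hL.1)]
    calc Gᵀ * (G⁻¹ᵀ * P * G⁻¹) * G = (G⁻¹ * G)ᵀ * P * (G⁻¹ * G) := by
          rw [transpose_mul]; simp only [Matrix.mul_assoc]
      _ = P := by rw [nonsing_inv_mul G hGdet, transpose_one, Matrix.one_mul, Matrix.mul_one]

/-- **The automorphism group of `S^n_+`**: a linear map `Γ` on `M_n(ℝ)` satisfies `Γ(S^n_+) = S^n_+`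
iff it is a congruence `X ↦ GᵀXG` (`G` invertible) on symmetric matrices.
[cite: Schneider1965, Thm. (onto psd preservers), via Sznajder2022 §2 Example 2 (held chunk p0004)] -/
theorem image_psdCone_eq_iff :
    ψ '' psdCone n = psdCone n ↔
      ∃ G : Matrix n n ℝ, IsUnit G ∧ ∀ S : Matrix n n ℝ, S.IsSymm → ψ S = Gᵀ * S * G :=
  ⟨exists_eq_transpose_mul_mul_of_image_psdCone_eq ψ,
    fun ⟨_, hG, hψ⟩ => image_psdCone_eq_of_eq_transpose_mul_mul ψ hG hψ⟩

end Main

/-! ### Two corollaries: homogeneity of `S^n_+`, and unital automorphisms (appended) -/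

section Corollaries

open scoped MatrixOrder

/-- **`S^n_+` is homogeneous** (Sznajder 2022, §1: the cone of squares of a Euclidean Jordan algebra "is
self-dual and homogeneous", i.e. its automorphism group acts transitively on the interior): for positive
definite `A, B` there is an invertible `G` with `GᵀAG = B` — and `X ↦ GᵀXG` is an automorphism of
`S^n_+` (`image_psdCone_eq_of_eq_transpose_mul_mul`). Proof: `A = RR`, `B = SS` with the (symmetric,
invertible) psd square roots, `G = R⁻¹S`. [cite: Sznajder2022, §1 (held chunk p0003)] -/
theorem exists_transpose_mul_mul_eq_of_posDef {A B : Matrix n n ℝ} (hA : A.PosDef) (hB : B.PosDef) :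
    ∃ G : Matrix n n ℝ, IsUnit G ∧ Gᵀ * A * G = B := by
  -- square roots
  set R : Matrix n n ℝ := CFC.sqrt A with hR
  set S : Matrix n n ℝ := CFC.sqrt B with hS
  have hRpsd : R.PosSemidef := (CFC.sqrt_nonneg A).posSemidef
  have hSpsd : S.PosSemidef := (CFC.sqrt_nonneg B).posSemidef
  have hRR : R * R = A := CFC.sqrt_mul_sqrt_self A hA.posSemidef.nonneg
  have hSS : S * S = B := CFC.sqrt_mul_sqrt_self B hB.posSemidef.nonneg
  have hRt : Rᵀ = R := by
    have h := hRpsd.1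
    rwa [Matrix.IsHermitian, conjTranspose_eq_transpose_of_trivial] at h
  have hSt : Sᵀ = S := by
    have h := hSpsd.1
    rwa [Matrix.IsHermitian, conjTranspose_eq_transpose_of_trivial] at h
  have hRdet : IsUnit R.det := by
    have h := (isUnit_iff_isUnit_det A).mp hA.isUnit
    rw [← hRR, det_mul] at h
    exact (IsUnit.mul_iff.mp h).1
  have hSdet : IsUnit S.det := by
    have h := (isUnit_iff_isUnit_det B).mp hB.isUnit
    rw [← hSS, det_mul] at h
    exact (IsUnit.mul_iff.mp h).1
  refine ⟨R⁻¹ * S, ?_, ?_⟩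
  · rw [isUnit_iff_isUnit_det, det_mul]
    refine IsUnit.mul ((isUnit_iff_isUnit_det _).mp ?_) hSdet
    rw [isUnit_nonsing_inv_iff]
    exact (isUnit_iff_isUnit_det R).mpr hRdet
  · rw [transpose_mul, hSt, transpose_nonsing_inv, hRt, ← hRR]
    calc S * R⁻¹ * (R * R) * (R⁻¹ * S) = S * (R⁻¹ * R) * (R * R⁻¹) * S := by
          simp only [Matrix.mul_assoc]
      _ = B := by rw [nonsing_inv_mul R hRdet, mul_nonsing_inv R hRdet, Matrix.mul_one, Matrix.mul_one, hSS]

variable (ψ : Matrix n n ℝ →ₗ[ℝ] Matrix n n ℝ)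

/-- **Unital automorphisms of `S^n_+` are orthogonal congruences** (Sznajder 2022, §2 Example 2, second
display: "for `Λ ∈ Aut(S^n)`, there exists an orthogonal matrix `U` such that `Λ(X) = UXUᵀ`" — the
automorphisms of the Jordan algebra `S^n`, which are the cone automorphisms fixing the unit `I`). Typed
as the corollary of Schneider's theorem for a cone automorphism with `Γ(I) = I`: the congruence matrix
`G` is orthogonal, `GᵀG = GGᵀ = I`. [cite: Sznajder2022, §2 Example 2 (held chunk p0004); Schneider1965,
Thm. (onto psd preservers)] -/
theorem exists_orthogonal_of_image_psdCone_eq_of_map_one (hψ : ψ '' psdCone n = psdCone n)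
    (h1 : ψ 1 = 1) :
    ∃ G : Matrix n n ℝ, Gᵀ * G = 1 ∧ G * Gᵀ = 1 ∧ ∀ S : Matrix n n ℝ, S.IsSymm → ψ S = Gᵀ * S * G := by
  obtain ⟨G, -, hG⟩ := exists_eq_transpose_mul_mul_of_image_psdCone_eq ψ hψ
  have hGG : Gᵀ * G = 1 := by
    have h := hG 1 isSymm_one
    rw [h1, Matrix.mul_one] at h
    exact h.symm
  exact ⟨G, hGG, mul_eq_one_comm.mp hGG, hG⟩

end Corollaries

end Literature.LinearAlgebra.Matrix.PsdConeLinearAutomorphisms
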